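import Literature.Analysis.FluidPDE.HeatGradDivEnergy
import Mathlib.Analysis.SpecialFunctions.ImproperIntegrals
import Mathlib.MeasureTheory.Integral.IntegralEqImproper
import HarnessLib

/-!
# The heat-subordinated gradient corrector `G(t) = ∫_{σ>t} ∇div e^{σΔ}g dσ`

Analysis/FluidPDE support file (theorems only) on the discharge path of
`Literature.Analysis.FluidPDE.AlbrittonBarker2019_liouville_weakL3_backward`, step "initial
layer for weak-`L³` data" (Barker–Seregin–Šverák, arXiv:1603.03211, Lemma 3.4). For a bounded
measurable vector field `g ∈ Lᵖ(E; E)`, `1 ≤ p < ∞`, the field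

  `G(t)(x) = ∫_{σ > t} ∇div e^{σΔ}g (x) dσ`     (`t > 0`)

has divergence `div G(t) = -div e^{tΔ}g`, so that for a weakly divergence-free sum `g + g̃`
the field `e^{tΔ}g̃ - G̃(t)`, `G̃(t) = ∫_{σ>t} ∇div e^{σΔ}g̃ = -G(t)`, is divergence free and caloric;
this replaces the Leray projection of the splitting `u₀ = ḡ + g̃` of loc. cit., Lemma 2.1. This
file proves (the corrector is written out, no definition is introduced):

* `norm_integral_gradDiv_heatExtension_Ioi_le` — the integral converges absolutely,
  `‖G(t)(x)‖ ≤ (C/κ) t^{-κ} ‖g‖_p`, `κ = (d/2)(1/p)` (`dim E > 0`, `p < ∞`);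
* `integral_gradDiv_heatExtension_Ioi_semigroup` — `G(t) = e^{(t−t₀)Δ}G(t₀)` for `0 < t₀ < t`
  (hence `integral_gradDiv_heatExtension_Ioi_smooth`: `G(t)` is `C^∞` with bounded derivatives);
* `hasFDerivAt_integral_gradDiv_Ioi`, `divergence_integral_gradDiv_heatExtension_Ioi` —
  differentiation under the integral and `div G(t) = -div e^{tΔ}g`;
* `norm_fderiv_integral_gradDiv_Ioi_le`, `eLpNorm_integral_gradDiv_Ioi_le_of_lt`,
  `eLpNorm_fderiv_integral_gradDiv_Ioi_le_of_lt` — sup and `L^q` bounds of `G(t)` and `D G(t)`;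
* `eLpNorm_integral_gradDiv_Ioi_two_le` — if `g + g'` is weakly divergence free with
  `g' ∈ L² ∩ L^∞`, then `‖G(t)‖_{L²} ≤ 2(‖tr‖² + 1)‖g'‖_{L²}` (truncated bound of
  `HeatGradDivEnergy` and Fatou);
* `continuousOn_integral_gradDiv_Ioi_uncurry`, `hasDerivAt_integral_gradDiv_Ioi` — joint
  continuity of `G`, `DG`, `ΔG` on `(0,∞) × E` and the heat equation `∂_t G = ΔG`.

## References

* T. Barker, G. Seregin, V. Šverák, *On stability of weak Navier–Stokes solutions with large
  `L^{3,∞}` initial data*, Comm. PDE 43 (2018) = arXiv:1603.03211, Lemma 2.1, Lemma 3.4.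
  [`BarkerSeregin2016`]
* Y. Giga, M.-H. Giga, J. Saal, *Nonlinear PDEs* (2010), §1.1.3. [`GigaGigaSaal2010`]
-/

noncomputable section

open MeasureTheory Set Function Filter Metric TopologicalSpace InnerProductSpace
open _root_.Topology
open scoped NNReal ENNReal Laplacian RealInnerProductSpace

namespace Literature.Analysis.FluidPDE

open UnboundedOperators

variable {E : Type*} [NormedAddCommGroup E] [InnerProductSpace ℝ E] [FiniteDimensional ℝ E]
  [MeasurableSpace E] [BorelSpace E]

section Corrector

variable {g : E → E} {p : ℝ≥0∞}

/-- **Absolute convergence of `∫_{σ>t} ∇div e^{σΔ}g dσ`**: for bounded measurable `g ∈ Lᵖ`,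
`1 ≤ p < ∞`, `dim E > 0` and `t > 0`, `σ ↦ ∇div e^{σΔ}g (x)` is integrable on `(t, ∞)` and
`‖∫_{σ>t} ∇div e^{σΔ}g (x) dσ‖ ≤ ∫_{σ>t} ‖…‖ ≤ (C/κ) t^{-κ} ‖g‖_p`, `κ = (d/2)(1/p)` (the sup bound
`‖∇div e^{σΔ}g‖_∞ ≤ C σ^{-1-κ}‖g‖_p`). [cite: GigaGigaSaal2010, §1.1.3] -/
theorem norm_integral_gradDiv_heatExtension_Ioi_le [Nontrivial E] (hp : 1 ≤ p) (hp' : p ≠ ∞) :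
    ∃ C : ℝ, 0 ≤ C ∧ ∀ (g : E → E), MemLp g p volume → ∀ K : ℝ, (∀ z, ‖g z‖ ≤ K) →
      ∀ t : ℝ, 0 < t →
      (∀ x, IntegrableOn (fun σ => gradient (VectorCalculus.divergence (heatExtension g σ)) x) (Ioi t)) ∧
      (∀ x, ∫ σ in Ioi t, ‖gradient (VectorCalculus.divergence (heatExtension g σ)) x‖ ≤
        C * t ^ (-((Module.finrank ℝ E : ℝ) / 2 * (1 / p).toReal)) * (eLpNorm g p volume).toReal) ∧
      (∀ x, ‖∫ σ in Ioi t, gradient (VectorCalculus.divergence (heatExtension g σ)) x‖ ≤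
        C * t ^ (-((Module.finrank ℝ E : ℝ) / 2 * (1 / p).toReal)) * (eLpNorm g p volume).toReal) := by
  obtain ⟨C, hC0, hC⟩ := norm_gradDiv_heatExtension_le (E := E) (p := p) hp
  set κ : ℝ := (Module.finrank ℝ E : ℝ) / 2 * (1 / p).toReal with hκ
  have hd : (0 : ℝ) < (Module.finrank ℝ E : ℝ) := by exact_mod_cast Module.finrank_pos
  have hθ : 0 < (1 / p).toReal := by
    rw [one_div, ENNReal.toReal_pos_iff]
    exact ⟨ENNReal.inv_pos.2 hp', ENNReal.inv_lt_top.2 (lt_of_lt_of_le zero_lt_one hp)⟩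
  have hκ0 : 0 < κ := by positivity
  refine ⟨C / κ, by positivity, fun g hg K hK t ht => ?_⟩
  set Gp : ℝ := (eLpNorm g p volume).toReal with hGp
  have hGp0 : 0 ≤ Gp := ENNReal.toReal_nonneg
  -- the dominating function and its integral
  have hdom_int : IntegrableOn (fun σ : ℝ => C * σ ^ (-(1 + κ)) * Gp) (Ioi t) :=
    ((integrableOn_Ioi_rpow_of_lt (by linarith) ht).const_mul C).mul_const Gp
  have hdom_val : ∫ σ in Ioi t, C * σ ^ (-(1 + κ)) * Gp = C / κ * t ^ (-κ) * Gp := by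
    rw [integral_mul_const, integral_const_mul, integral_Ioi_rpow_of_lt (by linarith) ht]
    have h1 : -(1 + κ) + 1 = -κ := by ring
    rw [h1]
    field_simp
  have hbound : ∀ σ ∈ Ioi t, ∀ x, ‖gradient (VectorCalculus.divergence (heatExtension g σ)) x‖ ≤
      C * σ ^ (-(1 + κ)) * Gp := fun σ hσ x => hC g hg K hK σ (ht.trans hσ) x
  have hmeas : ∀ x, AEStronglyMeasurable (fun σ => gradient (VectorCalculus.divergence (heatExtension g σ)) x)
      ((volume : Measure ℝ).restrict (Ioi t)) := fun x =>
    ((continuousOn_gradDiv_heatExtension_time hg.1 hK x).mono fun σ hσ => ht.trans hσ).aestronglyMeasurable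
      measurableSet_Ioi
  have hint : ∀ x, IntegrableOn (fun σ => gradient (VectorCalculus.divergence (heatExtension g σ)) x) (Ioi t) :=
    fun x => hdom_int.mono' (hmeas x) ((ae_restrict_mem measurableSet_Ioi).mono fun σ hσ => hbound σ hσ x)
  have hnorm : ∀ x, ∫ σ in Ioi t, ‖gradient (VectorCalculus.divergence (heatExtension g σ)) x‖ ≤
      C / κ * t ^ (-κ) * Gp := fun x => by
    rw [← hdom_val]
    exact setIntegral_mono_on (hint x).norm hdom_int measurableSet_Ioi fun σ hσ => hbound σ hσ x
  exact ⟨hint, hnorm, fun x => (norm_integral_le_integral_norm _).trans (hnorm x)⟩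

/-- **Measurability on `E × S`, `S ⊆ (0, ∞)`**, of a function continuous on `E × (0, ∞)`, for the
product of Lebesgue measure with Lebesgue measure restricted to `S`; and `S` carries the second
marginal. [folklore] -/
theorem aestronglyMeasurable_prod_restrict_of_continuousOn {X : Type*} [TopologicalSpace X]
    [PseudoMetrizableSpace X] {F : E × ℝ → X}
    (hF : ContinuousOn F ((univ : Set E) ×ˢ Ioi (0 : ℝ))) {S : Set ℝ} (hS : MeasurableSet S)
    (hS0 : S ⊆ Ioi 0) :
    AEStronglyMeasurable F ((volume : Measure E).prod ((volume : Measure ℝ).restrict S)) ∧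
    (∀ᵐ z ∂((volume : Measure E).prod ((volume : Measure ℝ).restrict S)), z.2 ∈ S) := by
  set ρ : Measure (E × ℝ) := (volume : Measure E).prod ((volume : Measure ℝ).restrict S) with hρ
  have hnullT : ∀ T : Set ℝ, MeasurableSet T → S ⊆ T → ρ ((univ : Set E) ×ˢ T)ᶜ = 0 := by
    intro T hT hST
    have hc' : ((univ : Set E) ×ˢ T)ᶜ = (univ : Set E) ×ˢ Tᶜ := by ext q; simp
    rw [hc', hρ, Measure.prod_prod, Measure.restrict_apply hT.compl]
    have he : Tᶜ ∩ S = ∅ := by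
      ext σ
      simp only [mem_inter_iff, mem_compl_iff, mem_empty_iff_false, iff_false, not_and]
      intro h1 h2; exact h1 (hST h2)
    rw [he, measure_empty, mul_zero]
  have h := hF.aestronglyMeasurable (μ := ρ) (MeasurableSet.univ.prod measurableSet_Ioi)
  have hρeq : ρ.restrict ((univ : Set E) ×ˢ Ioi (0 : ℝ)) = ρ :=
    Measure.restrict_eq_self_of_ae_mem (mem_ae_iff.2 (hnullT _ measurableSet_Ioi hS0))
  rw [hρeq] at h
  refine ⟨h, ?_⟩
  have h2 : ∀ᵐ z ∂ρ, z ∈ (univ : Set E) ×ˢ S := mem_ae_iff.2 (hnullT S hS Subset.rfl)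
  exact h2.mono fun z hz => hz.2

/-- Translation of a half-line integral: `∫_{s>t₀} f(s + τ) ds = ∫_{σ>t₀+τ} f(σ) dσ`. [folklore] -/
theorem setIntegral_Ioi_comp_add_right_vec {X : Type*} [NormedAddCommGroup X] [NormedSpace ℝ X]
    (f : ℝ → X) (t₀ τ : ℝ) :
    ∫ s in Ioi t₀, f (s + τ) = ∫ σ in Ioi (t₀ + τ), f σ := by
  rw [← integral_indicator measurableSet_Ioi, ← integral_indicator measurableSet_Ioi]
  have h : (fun s => (Ioi t₀).indicator (fun s => f (s + τ)) s) = fun s => (Ioi (t₀ + τ)).indicator f (s + τ) := by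
    funext s
    by_cases hs : s ∈ Ioi t₀
    · have hs' : s + τ ∈ Ioi (t₀ + τ) := by simp only [mem_Ioi] at hs ⊢; linarith
      rw [indicator_of_mem hs, indicator_of_mem hs']
    · have hs' : s + τ ∉ Ioi (t₀ + τ) := by simp only [mem_Ioi, not_lt] at hs ⊢; linarith
      rw [indicator_of_notMem hs, indicator_of_notMem hs']
  rw [h]
  exact integral_add_right_eq_self (μ := (volume : Measure ℝ)) (fun σ => (Ioi (t₀ + τ)).indicator f σ) τ

/-- **Semigroup law of the corrector**: for bounded measurable `g ∈ Lᵖ` (`1 ≤ p < ∞`) and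
`0 < t₀ < t`, `∫_{σ>t} ∇div e^{σΔ}g dσ = e^{(t−t₀)Δ} ∫_{s>t₀} ∇div e^{sΔ}g ds` pointwise
(`∇div e^{(s+τ)Δ}g = e^{τΔ}∇div e^{sΔ}g`, Fubini against the heat kernel, translation in `s`).
[cite: LemarieRieusset2016, §6.2] -/
theorem integral_gradDiv_heatExtension_Ioi_semigroup [Nontrivial E] (hg : MemLp g p volume)
    (hp : 1 ≤ p) (hp' : p ≠ ∞) {K : ℝ} (hK : ∀ z, ‖g z‖ ≤ K) {t₀ t : ℝ} (ht₀ : 0 < t₀) (ht : t₀ < t)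
    (x : E) :
    ∫ σ in Ioi t, gradient (VectorCalculus.divergence (heatExtension g σ)) x =
      heatExtension (fun y => ∫ s in Ioi t₀, gradient (VectorCalculus.divergence (heatExtension g s)) y)
        (t - t₀) x := by
  haveI : CompleteSpace E := FiniteDimensional.complete ℝ E
  set τ : ℝ := t - t₀ with hτdef
  have hτ : 0 < τ := sub_pos.2 ht
  obtain ⟨C, hC0, hC⟩ := norm_gradDiv_heatExtension_le (E := E) (p := p) hp
  set κ : ℝ := (Module.finrank ℝ E : ℝ) / 2 * (1 / p).toReal with hκ
  have hd : (0 : ℝ) < (Module.finrank ℝ E : ℝ) := by exact_mod_cast Module.finrank_pos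
  have hθ : 0 < (1 / p).toReal := by
    rw [one_div, ENNReal.toReal_pos_iff]
    exact ⟨ENNReal.inv_pos.2 hp', ENNReal.inv_lt_top.2 (lt_of_lt_of_le zero_lt_one hp)⟩
  have hκ0 : 0 < κ := by positivity
  set Gp : ℝ := (eLpNorm g p volume).toReal with hGp
  -- the dominating function `K_τ(y) · C s^{-1-κ} ‖g‖_p` on `E × (t₀, ∞)`
  have hh_int : Integrable (fun s : ℝ => C * s ^ (-(1 + κ)) * Gp) ((volume : Measure ℝ).restrict (Ioi t₀)) :=
    ((integrableOn_Ioi_rpow_of_lt (by linarith) ht₀).const_mul C).mul_const Gp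
  have hK_int : Integrable (heatKernel (E := E) τ) := integrable_heatKernel_holds hτ
  have hb_int : Integrable (fun z : E × ℝ => heatKernel τ z.1 * (C * z.2 ^ (-(1 + κ)) * Gp))
      ((volume : Measure E).prod ((volume : Measure ℝ).restrict (Ioi t₀))) := hK_int.mul_prod hh_int
  -- the integrand `(y, s) ↦ K_τ(y) • I(s)(x - y)` is measurable and dominated
  set H : E × ℝ → E := fun z => heatKernel τ z.1 • gradient (VectorCalculus.divergence (heatExtension g z.2)) (x - z.1) with hH
  have hIc := continuousOn_gradDiv_heatExtension_uncurry hg.1 hK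
  have hHc : ContinuousOn H ((univ : Set E) ×ˢ Ioi (0 : ℝ)) := by
    have h1 : ContinuousOn (fun z : E × ℝ => gradient (VectorCalculus.divergence (heatExtension g z.2)) (x - z.1))
        ((univ : Set E) ×ˢ Ioi (0 : ℝ)) := by
      have h2 : ContinuousOn ((fun q : ℝ × E => gradient (VectorCalculus.divergence (heatExtension g q.1)) q.2) ∘
          (fun z : E × ℝ => (z.2, x - z.1))) ((univ : Set E) ×ˢ Ioi (0 : ℝ)) :=
        hIc.comp (by fun_prop) fun z hz => mk_mem_prod (mem_prod.1 hz).2 (mem_univ _)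
      exact h2.congr fun z _ => rfl
    exact ((continuous_heatKernel τ).comp continuous_fst).continuousOn.smul h1
  obtain ⟨hHm, hae⟩ := aestronglyMeasurable_prod_restrict_of_continuousOn hHc measurableSet_Ioi
    (fun s hs => ht₀.trans hs)
  have hHint : Integrable H ((volume : Measure E).prod ((volume : Measure ℝ).restrict (Ioi t₀))) := by
    refine hb_int.mono' hHm (hae.mono fun z hz => ?_)
    rw [hH, norm_smul, Real.norm_of_nonneg (heatKernel_pos hτ z.1).le]
    exact mul_le_mul_of_nonneg_left (hC g hg K hK z.2 (ht₀.trans hz) _) (heatKernel_pos hτ z.1).le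
  -- Fubini
  have hswap := integral_integral_swap
    (f := fun (y : E) (s : ℝ) => heatKernel τ y • gradient (VectorCalculus.divergence (heatExtension g s)) (x - y)) hHint
  -- the right-hand side
  rw [heatExtension_apply]
  have hinner : ∀ y, heatKernel τ y • (∫ s in Ioi t₀, gradient (VectorCalculus.divergence (heatExtension g s)) (x - y)) =
      ∫ s in Ioi t₀, heatKernel τ y • gradient (VectorCalculus.divergence (heatExtension g s)) (x - y) :=
    fun y => (integral_smul _ _).symm
  simp_rw [hinner]
  rw [hswap]
  -- `∫ y, K_τ(y) • I(s)(x - y) = e^{τΔ} I(s) (x) = I(s + τ)(x)`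
  have hslice : ∀ s ∈ Ioi t₀, ∫ y, heatKernel τ y • gradient (VectorCalculus.divergence (heatExtension g s)) (x - y) =
      gradient (VectorCalculus.divergence (heatExtension g (s + τ))) x := by
    intro s hs
    rw [← heatExtension_apply]
    exact (gradDiv_heatExtension_semigroup hg.1 hK (ht₀.trans hs) hτ x).symm
  rw [setIntegral_congr_fun measurableSet_Ioi hslice, setIntegral_Ioi_comp_add_right_vec (fun σ => gradient (VectorCalculus.divergence (heatExtension g σ)) x) t₀ τ]
  congr 1
  rw [hτdef]; ring_nf

/-- **Measurability of the corrector slice** `x ↦ ∫_{σ>t} ∇div e^{σΔ}g (x) dσ`. [folklore] -/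
theorem aestronglyMeasurable_integral_gradDiv_Ioi (hgm : AEStronglyMeasurable g volume) {K : ℝ}
    (hK : ∀ z, ‖g z‖ ≤ K) {t : ℝ} (ht : 0 < t) :
    AEStronglyMeasurable (fun x => ∫ σ in Ioi t, gradient (VectorCalculus.divergence (heatExtension g σ)) x)
      (volume : Measure E) := by
  have hIc := continuousOn_gradDiv_heatExtension_uncurry hgm hK
  have h2 : ContinuousOn ((fun q : ℝ × E => gradient (VectorCalculus.divergence (heatExtension g q.1)) q.2) ∘
      (Prod.swap : E × ℝ → ℝ × E)) ((univ : Set E) ×ˢ Ioi (0 : ℝ)) :=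
    hIc.comp continuous_swap.continuousOn fun q hq => mk_mem_prod (mem_prod.1 hq).2 (mem_univ _)
  have hc : ContinuousOn (uncurry fun (x : E) (σ : ℝ) => gradient (VectorCalculus.divergence (heatExtension g σ)) x)
      ((univ : Set E) ×ˢ Ioi (0 : ℝ)) := h2.congr fun q _ => rfl
  obtain ⟨hm, -⟩ := aestronglyMeasurable_prod_restrict_of_continuousOn hc measurableSet_Ioi
    (fun σ hσ => ht.trans hσ)
  exact hm.integral_prod_right'

/-- **The corrector is a caloric extension of bounded measurable data, hence smooth with all
derivatives bounded**: `G(t) = e^{(t/2)Δ}G(t/2)`. [folklore] -/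
theorem integral_gradDiv_heatExtension_Ioi_smooth [Nontrivial E] (hg : MemLp g p volume)
    (hp : 1 ≤ p) (hp' : p ≠ ∞) {K : ℝ} (hK : ∀ z, ‖g z‖ ≤ K) {t : ℝ} (ht : 0 < t) :
    ContDiff ℝ (⊤ : ℕ∞) (fun x => ∫ σ in Ioi t, gradient (VectorCalculus.divergence (heatExtension g σ)) x) ∧
    ∃ B : ℕ → ℝ, ∀ k (x : E),
      ‖iteratedFDeriv ℝ k (fun x => ∫ σ in Ioi t, gradient (VectorCalculus.divergence (heatExtension g σ)) x) x‖ ≤ B k := by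
  haveI : CompleteSpace E := FiniteDimensional.complete ℝ E
  have ht2 : 0 < t / 2 := by positivity
  obtain ⟨C, hC0, hC⟩ := norm_integral_gradDiv_heatExtension_Ioi_le (E := E) (p := p) hp hp'
  obtain ⟨-, -, hB⟩ := hC g hg K hK (t / 2) ht2
  have hfun : (fun x => ∫ σ in Ioi t, gradient (VectorCalculus.divergence (heatExtension g σ)) x) =
      heatExtension (fun y => ∫ s in Ioi (t / 2), gradient (VectorCalculus.divergence (heatExtension g s)) y)
        (t / 2) := by
    funext x
    have h := integral_gradDiv_heatExtension_Ioi_semigroup hg hp hp' hK ht2 (by linarith : t / 2 < t) x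
    rwa [show t - t / 2 = t / 2 by ring] at h
  rw [hfun]
  exact heatExtension_bounds_of_bound (aestronglyMeasurable_integral_gradDiv_Ioi hg.1 hK ht2) hB ht2

/-- Joint continuity of `(σ, x) ↦ D(∇div e^{σΔ}g)(x)` on `(0,∞) × E`. [folklore] -/
theorem continuousOn_fderiv_gradDiv_heatExtension_uncurry (hgm : AEStronglyMeasurable g volume) {K : ℝ}
    (hK : ∀ z, ‖g z‖ ≤ K) :
    ContinuousOn (fun q : ℝ × E => fderiv ℝ (gradient (VectorCalculus.divergence (heatExtension g q.1))) q.2)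
      (Ioi (0 : ℝ) ×ˢ univ) := by
  haveI : CompleteSpace E := FiniteDimensional.complete ℝ E
  refine continuousOn_of_forall_continuousAt fun q hq => ?_
  obtain ⟨hq1, -⟩ := mem_prod.1 hq
  have hσ : 0 < q.1 := hq1
  have ha : 0 < q.1 / 2 := by positivity
  obtain ⟨-, hsI, -, ⟨D, hD⟩⟩ := gradDiv_heatExtension_smooth hgm hK ha
  obtain ⟨hD0, -, -⟩ := bounds_zero_one_two hD
  have hmem : MemLp (gradient (VectorCalculus.divergence (heatExtension g (q.1 / 2)))) ∞ (volume : Measure E) :=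
    memLp_top_of_bound hsI.continuous.aestronglyMeasurable (D 0) (Eventually.of_forall hD0)
  have hF : ContinuousOn (fun r : ℝ × E =>
      fderiv ℝ (heatExtension (gradient (VectorCalculus.divergence (heatExtension g (q.1 / 2)))) (r.1 - q.1 / 2)) r.2)
      (Ioi (q.1 / 2) ×ˢ univ) := by
    have h1 : ContinuousOn (fun r : ℝ × E =>
        fderiv ℝ (heatExtension (gradient (VectorCalculus.divergence (heatExtension g (q.1 / 2)))) r.1) r.2)
        (Ioi 0 ×ˢ univ) :=
      continuousOn_clm_apply.2 fun v => continuousOn_uncurry_fderiv_heatExtension_of_memLp hmem le_top v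
    refine h1.comp (f := fun r : ℝ × E => (r.1 - q.1 / 2, r.2)) (by fun_prop) fun r hr => ?_
    obtain ⟨hr1, -⟩ := mem_prod.1 hr
    exact mk_mem_prod (show 0 < r.1 - q.1 / 2 from sub_pos.2 hr1) (mem_univ _)
  have hU : Ioi (q.1 / 2) ×ˢ (univ : Set E) ∈ 𝓝 q := by
    refine (isOpen_Ioi.prod isOpen_univ).mem_nhds (mk_mem_prod ?_ (mem_univ _))
    show q.1 / 2 < q.1; linarith
  refine (hF.continuousAt hU).congr (Filter.eventuallyEq_of_mem hU fun r hr => ?_)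
  obtain ⟨hr1, -⟩ := mem_prod.1 hr
  rw [gradDiv_heatExtension_eq_of_lt hgm hK ha hr1]

/-- **Differentiation under the integral**: `D G(t)(x) = ∫_{σ>t} D(∇div e^{σΔ}g)(x) dσ`, the
derivative integrand being integrable (`‖D∇div e^{σΔ}g‖_∞ ≤ C σ^{-3/2-κ}‖g‖_p`). [folklore] -/
theorem hasFDerivAt_integral_gradDiv_Ioi [Nontrivial E] (hg : MemLp g p volume) (hp : 1 ≤ p)
    (hp' : p ≠ ∞) {K : ℝ} (hK : ∀ z, ‖g z‖ ≤ K) {t : ℝ} (ht : 0 < t) (x : E) :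
    IntegrableOn (fun σ => fderiv ℝ (gradient (VectorCalculus.divergence (heatExtension g σ))) x) (Ioi t) ∧
    HasFDerivAt (fun y => ∫ σ in Ioi t, gradient (VectorCalculus.divergence (heatExtension g σ)) y)
      (∫ σ in Ioi t, fderiv ℝ (gradient (VectorCalculus.divergence (heatExtension g σ))) x) x := by
  haveI : CompleteSpace E := FiniteDimensional.complete ℝ E
  obtain ⟨C, hC0, hC⟩ := norm_integral_gradDiv_heatExtension_Ioi_le (E := E) (p := p) hp hp'
  obtain ⟨hint, -, -⟩ := hC g hg K hK t ht
  obtain ⟨C', hC'0, hC'⟩ := norm_fderiv_gradDiv_heatExtension_le (E := E) (p := p) hp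
  set κ : ℝ := (Module.finrank ℝ E : ℝ) / 2 * (1 / p).toReal with hκ
  have hκ0 : 0 ≤ κ := by positivity
  set Gp : ℝ := (eLpNorm g p volume).toReal with hGp
  -- measurability in `σ`
  have hmeas : ∀ y, AEStronglyMeasurable (fun σ => gradient (VectorCalculus.divergence (heatExtension g σ)) y)
      ((volume : Measure ℝ).restrict (Ioi t)) := fun y =>
    ((continuousOn_gradDiv_heatExtension_time hg.1 hK y).mono fun σ hσ => ht.trans hσ).aestronglyMeasurable
      measurableSet_Ioi
  have hmeas' : AEStronglyMeasurable (fun σ => fderiv ℝ (gradient (VectorCalculus.divergence (heatExtension g σ))) x)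
      ((volume : Measure ℝ).restrict (Ioi t)) :=
    (((continuousOn_fderiv_gradDiv_heatExtension_uncurry hg.1 hK).comp (f := fun σ : ℝ => ((σ, x) : ℝ × E))
      (Continuous.prodMk_left x).continuousOn fun _ hσ => mk_mem_prod hσ (mem_univ x)).mono
      fun σ hσ => ht.trans hσ).aestronglyMeasurable measurableSet_Ioi
  -- domination of the derivative
  have hbound_int : Integrable (fun σ : ℝ => C' * σ ^ (-(3 / 2 + κ)) * Gp) ((volume : Measure ℝ).restrict (Ioi t)) :=
    ((integrableOn_Ioi_rpow_of_lt (by linarith) ht).const_mul C').mul_const Gp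
  have hbound : ∀ᵐ σ ∂((volume : Measure ℝ).restrict (Ioi t)), ∀ y ∈ (univ : Set E),
      ‖fderiv ℝ (gradient (VectorCalculus.divergence (heatExtension g σ))) y‖ ≤ C' * σ ^ (-(3 / 2 + κ)) * Gp :=
    (ae_restrict_mem measurableSet_Ioi).mono fun σ hσ y _ => hC' g hg K hK σ (ht.trans hσ) y
  have hdiff : ∀ᵐ σ ∂((volume : Measure ℝ).restrict (Ioi t)), ∀ y ∈ (univ : Set E),
      HasFDerivAt (fun y => gradient (VectorCalculus.divergence (heatExtension g σ)) y)
        (fderiv ℝ (gradient (VectorCalculus.divergence (heatExtension g σ))) y) y :=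
    (ae_restrict_mem measurableSet_Ioi).mono fun σ hσ y _ => by
      obtain ⟨-, hsI, -, -⟩ := gradDiv_heatExtension_smooth hg.1 hK (ht.trans hσ)
      exact ((hsI.differentiable (by simp)) y).hasFDerivAt
  have hder := hasFDerivAt_integral_of_dominated_of_fderiv_le (μ := (volume : Measure ℝ).restrict (Ioi t))
    (F := fun (y : E) (σ : ℝ) => gradient (VectorCalculus.divergence (heatExtension g σ)) y)
    (F' := fun (y : E) (σ : ℝ) => fderiv ℝ (gradient (VectorCalculus.divergence (heatExtension g σ))) y)
    (x₀ := x) univ_mem (Eventually.of_forall hmeas) (hint x) hmeas' hbound hbound_int hdiff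
  refine ⟨hbound_int.mono' hmeas' ((ae_restrict_mem measurableSet_Ioi).mono fun σ hσ =>
    hC' g hg K hK σ (ht.trans hσ) x), hder⟩

/-- **The divergence of the corrector**: `div (∫_{σ>t} ∇div e^{σΔ}g dσ) = -div e^{tΔ}g`
(`div ∇div e^{σΔ}g = Δ div e^{σΔ}g = ∂_σ div e^{σΔ}g`, the fundamental theorem of calculus on
`(t, ∞)` and `div e^{σΔ}g → 0` as `σ → ∞`). [folklore] -/
theorem divergence_integral_gradDiv_heatExtension_Ioi [Nontrivial E] (hg : MemLp g p volume)
    (hp : 1 ≤ p) (hp' : p ≠ ∞) {K : ℝ} (hK : ∀ z, ‖g z‖ ≤ K) {t : ℝ} (ht : 0 < t) (x : E) :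
    VectorCalculus.divergence
        (fun y => ∫ σ in Ioi t, gradient (VectorCalculus.divergence (heatExtension g σ)) y) x =
      -VectorCalculus.divergence (heatExtension g t) x := by
  haveI : CompleteSpace E := FiniteDimensional.complete ℝ E
  obtain ⟨hint', hder⟩ := hasFDerivAt_integral_gradDiv_Ioi hg hp hp' hK ht x
  set L : (E →L[ℝ] E) →L[ℝ] ℝ := traceCLM with hL
  rw [divergence_eq_traceCLM, hder.fderiv, ← hL, ← L.integral_comp_comm hint']
  -- `tr D(∇div e^{σΔ}g)(x) = div ∇div e^{σΔ}g (x) = Δ div e^{σΔ}g (x)`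
  have h1 : ∀ σ ∈ Ioi t, L (fderiv ℝ (gradient (VectorCalculus.divergence (heatExtension g σ))) x) =
      (Δ (VectorCalculus.divergence (heatExtension g σ))) x := fun σ hσ => by
    rw [hL, ← divergence_eq_traceCLM, laplacian_divergence_heatExtension_eq hg.1 hK (ht.trans hσ) x]
  rw [setIntegral_congr_fun measurableSet_Ioi h1]
  -- the fundamental theorem of calculus on `(t, ∞)`
  obtain ⟨C₀, hC₀0, hC₀⟩ := norm_divergence_heatExtension_le (E := E) (p := p) hp
  set κ₀ : ℝ := 1 / 2 + (Module.finrank ℝ E : ℝ) / 2 * (1 / p).toReal with hκ₀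
  have hκ₀0 : 0 < κ₀ := by positivity
  have hcont : ContinuousWithinAt (fun σ => VectorCalculus.divergence (heatExtension g σ) x) (Ici t) t :=
    ((continuousOn_divergence_heatExtension_time hg.1 hK x).continuousAt (Ioi_mem_nhds ht)).continuousWithinAt
  have hderiv : ∀ σ ∈ Ioi t, HasDerivAt (fun s => VectorCalculus.divergence (heatExtension g s) x)
      ((Δ (VectorCalculus.divergence (heatExtension g σ))) x) σ := fun σ hσ =>
    hasDerivAt_divergence_heatExtension hg hp hK (ht.trans hσ) x
  have hf'int : IntegrableOn (fun σ => (Δ (VectorCalculus.divergence (heatExtension g σ))) x) (Ioi t) := by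
    refine (L.integrable_comp hint').congr ?_
    exact (ae_restrict_mem measurableSet_Ioi).mono h1
  have hlim : Tendsto (fun σ => VectorCalculus.divergence (heatExtension g σ) x) atTop (𝓝 0) := by
    have hb : ∀ᶠ σ in atTop, ‖VectorCalculus.divergence (heatExtension g σ) x‖ ≤
        C₀ * σ ^ (-κ₀) * (eLpNorm g p volume).toReal := by
      filter_upwards [Ioi_mem_atTop 0] with σ hσ
      exact hC₀ g hg σ hσ x
    refine squeeze_zero_norm' hb ?_
    have h0 : Tendsto (fun σ : ℝ => C₀ * σ ^ (-κ₀) * (eLpNorm g p volume).toReal) atTop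
        (𝓝 (C₀ * 0 * (eLpNorm g p volume).toReal)) :=
      ((tendsto_rpow_neg_atTop hκ₀0).const_mul C₀).mul_const _
    simpa using h0
  rw [integral_Ioi_of_hasDerivAt_of_tendsto hcont hderiv hf'int hlim, zero_sub]

/-- **Sup bound of the derivative of the corrector**: `‖D G(t)(x)‖ ≤ C t^{-(1/2+κ)} ‖g‖_p`
(`G(t) = e^{(t/2)Δ}G(t/2)` and the bounded-data gradient bound). [cite: GigaGigaSaal2010, §1.1.3] -/
theorem norm_fderiv_integral_gradDiv_Ioi_le [Nontrivial E] (hp : 1 ≤ p) (hp' : p ≠ ∞) :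
    ∃ C : ℝ, 0 ≤ C ∧ ∀ (g : E → E), MemLp g p volume → ∀ K : ℝ, (∀ z, ‖g z‖ ≤ K) →
      ∀ t : ℝ, 0 < t → ∀ x,
      ‖fderiv ℝ (fun y => ∫ σ in Ioi t, gradient (VectorCalculus.divergence (heatExtension g σ)) y) x‖ ≤
        C * t ^ (-(1 / 2 + (Module.finrank ℝ E : ℝ) / 2 * (1 / p).toReal)) * (eLpNorm g p volume).toReal := by
  haveI : CompleteSpace E := FiniteDimensional.complete ℝ E
  obtain ⟨C, hC0, hC⟩ := norm_integral_gradDiv_heatExtension_Ioi_le (E := E) (p := p) hp hp'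
  set κ : ℝ := (Module.finrank ℝ E : ℝ) / 2 * (1 / p).toReal with hκ
  have hκ0 : 0 ≤ κ := by positivity
  refine ⟨(2 : ℝ) ^ ((Module.finrank ℝ E : ℝ) / 2) * C * (2 : ℝ) ^ (1 / 2 + κ), by positivity,
    fun g hg K hK t ht x => ?_⟩
  have ht2 : 0 < t / 2 := by positivity
  obtain ⟨-, -, hB⟩ := hC g hg K hK (t / 2) ht2
  have hfun : (fun x => ∫ σ in Ioi t, gradient (VectorCalculus.divergence (heatExtension g σ)) x) =
      heatExtension (fun y => ∫ s in Ioi (t / 2), gradient (VectorCalculus.divergence (heatExtension g s)) y)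
        (t / 2) := by
    funext y
    have h := integral_gradDiv_heatExtension_Ioi_semigroup hg hp hp' hK ht2 (by linarith : t / 2 < t) y
    rwa [show t - t / 2 = t / 2 by ring] at h
  rw [hfun]
  have h1 := norm_fderiv_heatExtension_le_of_bounded (aestronglyMeasurable_integral_gradDiv_Ioi hg.1 hK ht2) hB ht2 x
  have hpow : (t / 2) ^ (-(1 / 2 : ℝ)) * (t / 2) ^ (-κ) = (2 : ℝ) ^ (1 / 2 + κ) * t ^ (-(1 / 2 + κ)) :=
    half_rpow_neg_mul_half_rpow_neg ht _ _
  calc ‖fderiv ℝ (heatExtension (fun y => ∫ s in Ioi (t / 2), gradient (VectorCalculus.divergence (heatExtension g s)) y) (t / 2)) x‖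
      ≤ (2 : ℝ) ^ ((Module.finrank ℝ E : ℝ) / 2) * (t / 2) ^ (-(1 / 2 : ℝ)) *
          (C * (t / 2) ^ (-κ) * (eLpNorm g p volume).toReal) := h1
    _ = (2 : ℝ) ^ ((Module.finrank ℝ E : ℝ) / 2) * C * ((t / 2) ^ (-(1 / 2 : ℝ)) * (t / 2) ^ (-κ)) *
          (eLpNorm g p volume).toReal := by ring
    _ = (2 : ℝ) ^ ((Module.finrank ℝ E : ℝ) / 2) * C * (2 : ℝ) ^ (1 / 2 + κ) * t ^ (-(1 / 2 + κ)) *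
          (eLpNorm g p volume).toReal := by rw [hpow]; ring

/-- Joint measurability of `(x, σ) ↦ ∇div e^{σΔ}g (x)` on `E × (t, ∞)`. [folklore] -/
theorem aestronglyMeasurable_gradDiv_heatExtension_prod_Ioi (hgm : AEStronglyMeasurable g volume) {K : ℝ}
    (hK : ∀ z, ‖g z‖ ≤ K) {t : ℝ} (ht : 0 < t) :
    AEStronglyMeasurable (uncurry fun (x : E) (σ : ℝ) => gradient (VectorCalculus.divergence (heatExtension g σ)) x)
      ((volume : Measure E).prod ((volume : Measure ℝ).restrict (Ioi t))) := by
  have hIc := continuousOn_gradDiv_heatExtension_uncurry hgm hK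
  have h2 : ContinuousOn ((fun q : ℝ × E => gradient (VectorCalculus.divergence (heatExtension g q.1)) q.2) ∘
      (Prod.swap : E × ℝ → ℝ × E)) ((univ : Set E) ×ˢ Ioi (0 : ℝ)) :=
    hIc.comp continuous_swap.continuousOn fun q hq => mk_mem_prod (mem_prod.1 hq).2 (mem_univ _)
  have hc : ContinuousOn (uncurry fun (x : E) (σ : ℝ) => gradient (VectorCalculus.divergence (heatExtension g σ)) x)
      ((univ : Set E) ×ˢ Ioi (0 : ℝ)) := h2.congr fun q _ => rfl
  exact (aestronglyMeasurable_prod_restrict_of_continuousOn hc measurableSet_Ioi (fun σ hσ => ht.trans hσ)).1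

/-- `∫⁻_{σ>t} ofReal(σ^{-(1+κ)}) dσ = ofReal(t^{-κ}/κ)` for `κ > 0`, `t > 0`. [folklore] -/
theorem lintegral_Ioi_ofReal_rpow_neg {κ t : ℝ} (hκ : 0 < κ) (ht : 0 < t) :
    ∫⁻ σ in Ioi t, ENNReal.ofReal (σ ^ (-(1 + κ))) = ENNReal.ofReal (t ^ (-κ) / κ) := by
  rw [← ofReal_integral_eq_lintegral_ofReal (integrableOn_Ioi_rpow_of_lt (by linarith) ht)
    ((ae_restrict_mem measurableSet_Ioi).mono fun σ hσ => Real.rpow_nonneg (ht.trans hσ).le _),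
    integral_Ioi_rpow_of_lt (by linarith) ht]
  congr 1
  rw [show -(1 + κ) + 1 = -κ by ring]
  field_simp

/-- **`L^q` bound of the corrector** (`p < q < ∞`, `dim E > 0`): `G(t) ∈ L^q` with
`‖G(t)‖_q ≤ (C/κ') t^{-κ'} ‖g‖_p`, `κ' = (d/2)(1/p − 1/q)` (Minkowski's integral inequality in
`σ` and the `Lᵖ → L^q` bound of `∇div e^{σΔ}g`). [cite: GigaGigaSaal2010, §1.1.3] -/
theorem eLpNorm_integral_gradDiv_Ioi_le_of_lt [Nontrivial E] (hp : 1 ≤ p) {q : ℝ≥0∞} (hpq : p < q)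
    (hq : q ≠ ∞) :
    ∃ C : ℝ≥0, ∀ (g : E → E), MemLp g p volume → ∀ K : ℝ, (∀ z, ‖g z‖ ≤ K) →
      ∀ t : ℝ, 0 < t →
      MemLp (fun x => ∫ σ in Ioi t, gradient (VectorCalculus.divergence (heatExtension g σ)) x) q volume ∧
      eLpNorm (fun x => ∫ σ in Ioi t, gradient (VectorCalculus.divergence (heatExtension g σ)) x) q volume ≤
        C * ENNReal.ofReal (t ^ (-((Module.finrank ℝ E : ℝ) / 2 * ((1 / p).toReal - (1 / q).toReal)))) *
          eLpNorm g p volume := by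
  obtain ⟨C, hC⟩ := eLpNorm_gradDiv_heatExtension_le (E := E) (p := p) hp hpq.le
  set κ' : ℝ := (Module.finrank ℝ E : ℝ) / 2 * ((1 / p).toReal - (1 / q).toReal) with hκ'
  have hd : (0 : ℝ) < (Module.finrank ℝ E : ℝ) := by exact_mod_cast Module.finrank_pos
  have hp' : p ≠ ∞ := ne_top_of_lt hpq
  have hdiff : 0 < (1 / p).toReal - (1 / q).toReal := by
    rw [sub_pos, one_div, one_div]
    exact ENNReal.toReal_strict_mono (ENNReal.inv_ne_top.2 (lt_of_lt_of_le zero_lt_one hp).ne')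
      (ENNReal.inv_lt_inv.2 hpq)
  have hκ'0 : 0 < κ' := by positivity
  refine ⟨C * (1 / κ').toNNReal, fun g hg K hK t ht => ?_⟩
  have hmeas := aestronglyMeasurable_gradDiv_heatExtension_prod_Ioi hg.1 hK ht
  have hmink := FunctionSpaces.eLpNorm_integral_le_lintegral_eLpNorm
    (μ := (volume : Measure E)) (ν := (volume : Measure ℝ).restrict (Ioi t)) hmeas (hp.trans hpq.le) hq
  have hbound : ∫⁻ σ in Ioi t, eLpNorm (fun x => gradient (VectorCalculus.divergence (heatExtension g σ)) x) q volume
      ≤ ∫⁻ σ in Ioi t, (C : ℝ≥0∞) * ENNReal.ofReal (σ ^ (-(1 + κ'))) * eLpNorm g p volume :=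
    lintegral_mono_ae ((ae_restrict_mem measurableSet_Ioi).mono fun σ hσ => (hC g hg K hK σ (ht.trans hσ)).2)
  have hval : ∫⁻ σ in Ioi t, (C : ℝ≥0∞) * ENNReal.ofReal (σ ^ (-(1 + κ'))) * eLpNorm g p volume =
      (C : ℝ≥0∞) * ENNReal.ofReal (t ^ (-κ') / κ') * eLpNorm g p volume := by
    rw [lintegral_mul_const' _ _ hg.eLpNorm_ne_top, lintegral_const_mul' _ _ ENNReal.coe_ne_top,
      lintegral_Ioi_ofReal_rpow_neg hκ'0 ht]
  have hfinal : eLpNorm (fun x => ∫ σ in Ioi t, gradient (VectorCalculus.divergence (heatExtension g σ)) x) q volume ≤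
      (C * (1 / κ').toNNReal : ℝ≥0) * ENNReal.ofReal (t ^ (-κ')) * eLpNorm g p volume := by
    refine (hmink.trans (hbound.trans_eq hval)).trans_eq ?_
    rw [ENNReal.coe_mul, show ((1 / κ').toNNReal : ℝ≥0∞) = ENNReal.ofReal (1 / κ') from rfl,
      div_eq_mul_one_div, ENNReal.ofReal_mul (Real.rpow_nonneg ht.le _)]
    ring
  refine ⟨⟨aestronglyMeasurable_integral_gradDiv_Ioi hg.1 hK ht, hfinal.trans_lt ?_⟩, hfinal⟩
  exact ENNReal.mul_lt_top (ENNReal.mul_lt_top ENNReal.coe_lt_top ENNReal.ofReal_lt_top) hg.eLpNorm_lt_top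

/-- **`L^q` bound of the derivative of the corrector** (`p < q < ∞`, `dim E > 0`):
`‖D G(t)‖_q ≤ C t^{-(1/2+κ')} ‖g‖_p` (`G(t) = e^{(t/2)Δ}G(t/2)`, the `L^q` gradient bound of the heat
semigroup and the `L^q` bound of `G(t/2)`). [cite: GigaGigaSaal2010, §1.1.3] -/
theorem eLpNorm_fderiv_integral_gradDiv_Ioi_le_of_lt [Nontrivial E] (hp : 1 ≤ p) {q : ℝ≥0∞} (hpq : p < q)
    (hq : q ≠ ∞) :
    ∃ C : ℝ≥0, ∀ (g : E → E), MemLp g p volume → ∀ K : ℝ, (∀ z, ‖g z‖ ≤ K) →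
      ∀ t : ℝ, 0 < t →
      eLpNorm (fderiv ℝ (fun x => ∫ σ in Ioi t, gradient (VectorCalculus.divergence (heatExtension g σ)) x)) q volume ≤
        C * ENNReal.ofReal (t ^ (-(1 / 2 + (Module.finrank ℝ E : ℝ) / 2 * ((1 / p).toReal - (1 / q).toReal)))) *
          eLpNorm g p volume := by
  haveI : CompleteSpace E := FiniteDimensional.complete ℝ E
  obtain ⟨C₁, hC₁⟩ := eLpNorm_integral_gradDiv_Ioi_le_of_lt (E := E) (p := p) hp hpq hq
  obtain ⟨C₂, hC₂⟩ := eLpNorm_fderiv_heatExtension_le_holds (E := E) (F := E) (hp.trans hpq.le)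
  set κ' : ℝ := (Module.finrank ℝ E : ℝ) / 2 * ((1 / p).toReal - (1 / q).toReal) with hκ'
  have hp' : p ≠ ∞ := ne_top_of_lt hpq
  have h2pos : (0 : ℝ) ≤ (2 : ℝ) ^ (1 / 2 + κ') := by positivity
  refine ⟨C₂ * C₁ * NNReal.mk _ h2pos, fun g hg K hK t ht => ?_⟩
  have ht2 : 0 < t / 2 := by positivity
  obtain ⟨hGmem, hGle⟩ := hC₁ g hg K hK (t / 2) ht2
  have hfun : (fun x => ∫ σ in Ioi t, gradient (VectorCalculus.divergence (heatExtension g σ)) x) =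
      heatExtension (fun y => ∫ s in Ioi (t / 2), gradient (VectorCalculus.divergence (heatExtension g s)) y)
        (t / 2) := by
    funext y
    have h := integral_gradDiv_heatExtension_Ioi_semigroup hg hp hp' hK ht2 (by linarith : t / 2 < t) y
    rwa [show t - t / 2 = t / 2 by ring] at h
  have key : ENNReal.ofReal ((t / 2) ^ (-(1 / 2 : ℝ))) * ENNReal.ofReal ((t / 2) ^ (-κ')) =
      ENNReal.ofReal ((2 : ℝ) ^ (1 / 2 + κ')) * ENNReal.ofReal (t ^ (-(1 / 2 + κ'))) := by
    rw [← ENNReal.ofReal_mul (Real.rpow_nonneg ht2.le _), ← ENNReal.ofReal_mul h2pos,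
      half_rpow_neg_mul_half_rpow_neg ht]
  rw [hfun]
  calc eLpNorm (fderiv ℝ (heatExtension
          (fun y => ∫ s in Ioi (t / 2), gradient (VectorCalculus.divergence (heatExtension g s)) y) (t / 2))) q volume
      ≤ C₂ * ENNReal.ofReal ((t / 2) ^ (-(1 / 2 : ℝ))) *
          eLpNorm (fun y => ∫ s in Ioi (t / 2), gradient (VectorCalculus.divergence (heatExtension g s)) y) q volume :=
        hC₂ _ hGmem (t / 2) ht2
    _ ≤ C₂ * ENNReal.ofReal ((t / 2) ^ (-(1 / 2 : ℝ))) * (C₁ * ENNReal.ofReal ((t / 2) ^ (-κ')) * eLpNorm g p volume) := by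
        gcongr
    _ = C₂ * C₁ * (ENNReal.ofReal ((t / 2) ^ (-(1 / 2 : ℝ))) * ENNReal.ofReal ((t / 2) ^ (-κ'))) * eLpNorm g p volume := by
        ring
    _ = (C₂ * C₁ * NNReal.mk _ h2pos : ℝ≥0) * ENNReal.ofReal (t ^ (-(1 / 2 + κ'))) * eLpNorm g p volume := by
        rw [key, ENNReal.coe_mul, ENNReal.coe_mul,
          show ((NNReal.mk _ h2pos : ℝ≥0) : ℝ≥0∞) = ENNReal.ofReal ((2 : ℝ) ^ (1 / 2 + κ')) from
            (ENNReal.ofReal_eq_coe_nnreal h2pos).symm]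
        ring

/-- **`L²` bound of the corrector of a divergence-free splitting** (the substitute for the
`L²`-boundedness of the Leray projector in Barker–Seregin–Šverák 2016, Lemma 3.4): if `g ∈ Lᵖ`
and `g' ∈ L²` are bounded measurable with `g + g'` weakly divergence free, then
`∇div e^{σΔ}g = -∇div e^{σΔ}g'`, and `‖∫_{σ>t} ∇div e^{σΔ}g dσ‖_{L²} ≤ 2(‖tr‖² + 1)‖g'‖_{L²}`
(the truncated bound `eLpNorm_integral_gradDiv_heatExtension_le` and Fatou). [cite: BarkerSeregin2016, Lemma 2.1 & Lemma 3.4] -/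
theorem eLpNorm_integral_gradDiv_Ioi_two_le [Nontrivial E] (hg : MemLp g p volume)
    {K : ℝ} (hK : ∀ z, ‖g z‖ ≤ K) {g' : E → E} (hg' : MemLp g' 2 volume) {K' : ℝ}
    (hK' : ∀ z, ‖g' z‖ ≤ K') (hdiv : IsWeaklyDivFree (g + g')) {t : ℝ} (ht : 0 < t) :
    MemLp (fun x => ∫ σ in Ioi t, gradient (VectorCalculus.divergence (heatExtension g σ)) x) 2 volume ∧
    eLpNorm (fun x => ∫ σ in Ioi t, gradient (VectorCalculus.divergence (heatExtension g σ)) x) 2 volume ≤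
      ENNReal.ofReal (2 * (‖(traceCLM : (E →L[ℝ] E) →L[ℝ] ℝ)‖ ^ 2 + 1)) * eLpNorm g' 2 volume := by
  -- the identification `∇div e^{σΔ}g = -∇div e^{σΔ}g'`
  have hneg : ∀ σ : ℝ, 0 < σ → ∀ x, gradient (VectorCalculus.divergence (heatExtension g σ)) x =
      -gradient (VectorCalculus.divergence (heatExtension g' σ)) x := fun σ hσ x => by
    rw [gradDiv_heatExtension_eq_neg_of_isWeaklyDivFree_add hg.1 hg'.1 hK hK' hdiv hσ]
    rfl
  -- the truncations of the `g'`-corrector and their limit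
  set F : ℕ → E → E := fun n x =>
    ∫ σ in Ioc t (t + ((n : ℝ) + 1)), gradient (VectorCalculus.divergence (heatExtension g' σ)) x with hF
  set Φ : E → E := fun x => ∫ σ in Ioi t, gradient (VectorCalculus.divergence (heatExtension g' σ)) x with hΦ
  obtain ⟨C, hC0, hC⟩ := norm_integral_gradDiv_heatExtension_Ioi_le (E := E) (p := 2) one_le_two (by norm_num)
  obtain ⟨hint', -, -⟩ := hC g' hg' K' hK' t ht
  have hunion : (⋃ n : ℕ, Ioc t (t + ((n : ℝ) + 1))) = Ioi t := by
    ext σ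
    simp only [mem_iUnion, mem_Ioc, mem_Ioi]
    constructor
    · rintro ⟨n, h1, -⟩; exact h1
    · intro h
      obtain ⟨n, hn⟩ := exists_nat_gt (σ - t)
      exact ⟨n, h, by linarith⟩
  have hlim : ∀ x, Tendsto (fun n => F n x) atTop (𝓝 (Φ x)) := by
    intro x
    have hmono : Monotone fun n : ℕ => Ioc t (t + ((n : ℝ) + 1)) := fun m n hmn =>
      Ioc_subset_Ioc le_rfl (by
        have h1 : (m : ℝ) ≤ n := by exact_mod_cast hmn
        linarith)
    have h := tendsto_setIntegral_of_monotone (μ := (volume : Measure ℝ))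
      (f := fun σ => gradient (VectorCalculus.divergence (heatExtension g' σ)) x)
      (fun n => measurableSet_Ioc) hmono (by rw [hunion]; exact hint' x)
    rwa [hunion] at h
  have hFm : ∀ n, AEStronglyMeasurable (F n) (volume : Measure E) := fun n =>
    (memLp_integral_gradDiv_heatExtension (R := t + ((n : ℝ) + 1)) hg' hK' ht).1.1
  have hFle : ∀ n, eLpNorm (F n) 2 volume ≤
      ENNReal.ofReal (2 * (‖(traceCLM : (E →L[ℝ] E) →L[ℝ] ℝ)‖ ^ 2 + 1)) * eLpNorm g' 2 volume := fun n =>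
    eLpNorm_integral_gradDiv_heatExtension_le (R := t + ((n : ℝ) + 1)) hg' hK' ht
  -- Fatou
  have hΦle : eLpNorm Φ 2 volume ≤
      ENNReal.ofReal (2 * (‖(traceCLM : (E →L[ℝ] E) →L[ℝ] ℝ)‖ ^ 2 + 1)) * eLpNorm g' 2 volume :=
    (Lp.eLpNorm_lim_le_liminf_eLpNorm hFm Φ (Eventually.of_forall hlim)).trans
      (liminf_le_of_frequently_le' (Eventually.of_forall hFle).frequently)
  -- `G_g(t) = -Φ`
  have hGeq : (fun x => ∫ σ in Ioi t, gradient (VectorCalculus.divergence (heatExtension g σ)) x) = -Φ := by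
    funext x
    simp only [hΦ, Pi.neg_apply, ← integral_neg]
    exact setIntegral_congr_fun measurableSet_Ioi fun σ hσ => hneg σ (ht.trans hσ) x
  rw [hGeq, eLpNorm_neg]
  refine ⟨⟨(aestronglyMeasurable_integral_gradDiv_Ioi hg'.1 hK' ht).neg, ?_⟩, hΦle⟩
  rw [eLpNorm_neg]
  exact hΦle.trans_lt (ENNReal.mul_lt_top ENNReal.ofReal_lt_top hg'.eLpNorm_lt_top)


/-! ### Time regularity of the corrector -/

/-- **A generic transfer lemma**: a function of `(t, x)` which, on every set `(t₀, ∞) × E`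
(`t₀ > 0`), is the caloric extension `e^{(t−t₀)Δ}f_{t₀}` of bounded measurable data `f_{t₀}`,
inherits on `(0,∞) × E` the continuity of any operation `(τ, x) ↦ Op(e^{τΔ}f)(x)` continuous on
`(0,∞) × E` for `L^∞` data. [folklore] -/
theorem continuousOn_of_local_heatExtension {X : Type*} [TopologicalSpace X] {Gt : ℝ → E → E}
    (Op : (E → E) → E → X)
    (hOp : ∀ f : E → E, MemLp f ∞ (volume : Measure E) →
      ContinuousOn (fun q : ℝ × E => Op (heatExtension f q.1) q.2) (Ioi 0 ×ˢ univ))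
    (hmem : ∀ t₀ : ℝ, 0 < t₀ → MemLp (Gt t₀) ∞ (volume : Measure E))
    (hloc : ∀ t₀ : ℝ, 0 < t₀ → ∀ t : ℝ, t₀ < t → Gt t = heatExtension (Gt t₀) (t - t₀)) :
    ContinuousOn (fun q : ℝ × E => Op (Gt q.1) q.2) (Ioi 0 ×ˢ univ) := by
  refine continuousOn_of_forall_continuousAt fun q hq => ?_
  obtain ⟨hq1, -⟩ := mem_prod.1 hq
  have hσ : 0 < q.1 := hq1
  have ha : 0 < q.1 / 2 := by positivity
  have hF : ContinuousOn (fun r : ℝ × E => Op (heatExtension (Gt (q.1 / 2)) (r.1 - q.1 / 2)) r.2)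
      (Ioi (q.1 / 2) ×ˢ univ) := by
    refine (hOp _ (hmem _ ha)).comp (f := fun r : ℝ × E => (r.1 - q.1 / 2, r.2)) (by fun_prop) fun r hr => ?_
    obtain ⟨hr1, -⟩ := mem_prod.1 hr
    exact mk_mem_prod (show 0 < r.1 - q.1 / 2 from sub_pos.2 hr1) (mem_univ _)
  have hU : Ioi (q.1 / 2) ×ˢ (univ : Set E) ∈ 𝓝 q := by
    refine (isOpen_Ioi.prod isOpen_univ).mem_nhds (mk_mem_prod ?_ (mem_univ _))
    show q.1 / 2 < q.1; linarith
  refine (hF.continuousAt hU).congr (Filter.eventuallyEq_of_mem hU fun r hr => ?_)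
  obtain ⟨hr1, -⟩ := mem_prod.1 hr
  rw [hloc _ ha _ hr1]

/-- The data of the transfer lemma for the corrector: `G(t₀) ∈ L^∞` and
`G(t) = e^{(t−t₀)Δ}G(t₀)` for `0 < t₀ < t`. [folklore] -/
theorem integral_gradDiv_Ioi_local [Nontrivial E] (hg : MemLp g p volume) (hp : 1 ≤ p) (hp' : p ≠ ∞)
    {K : ℝ} (hK : ∀ z, ‖g z‖ ≤ K) :
    (∀ t₀ : ℝ, 0 < t₀ → MemLp (fun x => ∫ σ in Ioi t₀, gradient (VectorCalculus.divergence (heatExtension g σ)) x)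
      ∞ (volume : Measure E)) ∧
    (∀ t₀ : ℝ, 0 < t₀ → ∀ t : ℝ, t₀ < t →
      (fun x => ∫ σ in Ioi t, gradient (VectorCalculus.divergence (heatExtension g σ)) x) =
        heatExtension (fun x => ∫ σ in Ioi t₀, gradient (VectorCalculus.divergence (heatExtension g σ)) x)
          (t - t₀)) := by
  obtain ⟨C, hC0, hC⟩ := norm_integral_gradDiv_heatExtension_Ioi_le (E := E) (p := p) hp hp'
  refine ⟨fun t₀ ht₀ => ?_, fun t₀ ht₀ t ht => funext fun x =>
    integral_gradDiv_heatExtension_Ioi_semigroup hg hp hp' hK ht₀ ht x⟩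
  obtain ⟨-, -, hB⟩ := hC g hg K hK t₀ ht₀
  exact memLp_top_of_bound (aestronglyMeasurable_integral_gradDiv_Ioi hg.1 hK ht₀) _ (Eventually.of_forall hB)

/-- **Joint continuity of the corrector, of its derivative and of its Laplacian** on `(0,∞) × E`.
[folklore] -/
theorem continuousOn_integral_gradDiv_Ioi_uncurry [Nontrivial E] (hg : MemLp g p volume) (hp : 1 ≤ p)
    (hp' : p ≠ ∞) {K : ℝ} (hK : ∀ z, ‖g z‖ ≤ K) :
    ContinuousOn (fun q : ℝ × E =>
      ∫ σ in Ioi q.1, gradient (VectorCalculus.divergence (heatExtension g σ)) q.2) (Ioi 0 ×ˢ univ) ∧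
    ContinuousOn (fun q : ℝ × E =>
      fderiv ℝ (fun x => ∫ σ in Ioi q.1, gradient (VectorCalculus.divergence (heatExtension g σ)) x) q.2)
      (Ioi 0 ×ˢ univ) ∧
    ContinuousOn (fun q : ℝ × E =>
      (Δ (fun x => ∫ σ in Ioi q.1, gradient (VectorCalculus.divergence (heatExtension g σ)) x)) q.2)
      (Ioi 0 ×ˢ univ) := by
  obtain ⟨hmem, hloc⟩ := integral_gradDiv_Ioi_local hg hp hp' hK
  refine ⟨?_, ?_, ?_⟩
  · exact continuousOn_of_local_heatExtension (Gt := fun t x =>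
      ∫ σ in Ioi t, gradient (VectorCalculus.divergence (heatExtension g σ)) x) (fun f x => f x)
      (fun f hf => continuousOn_uncurry_heatExtension_of_memLp hf le_top) hmem hloc
  · exact continuousOn_of_local_heatExtension (Gt := fun t x =>
      ∫ σ in Ioi t, gradient (VectorCalculus.divergence (heatExtension g σ)) x) (fun f x => fderiv ℝ f x)
      (fun f hf => continuousOn_clm_apply.2 fun v => continuousOn_uncurry_fderiv_heatExtension_of_memLp hf le_top v)
      hmem hloc
  · exact continuousOn_of_local_heatExtension (Gt := fun t x =>
      ∫ σ in Ioi t, gradient (VectorCalculus.divergence (heatExtension g σ)) x) (fun f x => (Δ f) x)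
      (fun f hf => continuousOn_uncurry_laplacian_heatExtension_of_memLp hf le_top) hmem hloc

/-- **The corrector solves the heat equation classically**: for `t > 0`,
`∂_t G(t)(x) = ΔG(t)(x)` (`G(s) = e^{(s−t₀)Δ}G(t₀)` near `t`, `t₀ = t/2`, and the heat equation for
the caloric extension of `L^∞` data). [cite: Folland1995PDE, §4.A Theorem (4.3)] -/
theorem hasDerivAt_integral_gradDiv_Ioi [Nontrivial E] (hg : MemLp g p volume) (hp : 1 ≤ p)
    (hp' : p ≠ ∞) {K : ℝ} (hK : ∀ z, ‖g z‖ ≤ K) {t : ℝ} (ht : 0 < t) (x : E) :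
    HasDerivAt (fun s => ∫ σ in Ioi s, gradient (VectorCalculus.divergence (heatExtension g σ)) x)
      ((Δ (fun y => ∫ σ in Ioi t, gradient (VectorCalculus.divergence (heatExtension g σ)) y)) x) t := by
  haveI : CompleteSpace E := FiniteDimensional.complete ℝ E
  obtain ⟨hmem, hloc⟩ := integral_gradDiv_Ioi_local hg hp hp' hK
  have ha : 0 < t / 2 := by positivity
  have haσ : t / 2 < t := by linarith
  have h1 : HasDerivAt (fun τ => heatExtension
      (fun y => ∫ σ in Ioi (t / 2), gradient (VectorCalculus.divergence (heatExtension g σ)) y) τ x)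
      ((Δ (heatExtension (fun y => ∫ σ in Ioi (t / 2), gradient (VectorCalculus.divergence (heatExtension g σ)) y)
        (t - t / 2))) x) (t - t / 2) :=
    hasDerivAt_heatExtension_time (by linarith) (hmem _ ha) le_top x
  have h2 := h1.comp_sub_const t (t / 2)
  rw [← hloc _ ha _ haσ] at h2
  refine h2.congr_of_eventuallyEq ?_
  filter_upwards [Ioi_mem_nhds haσ] with s hs
  exact congrFun (hloc _ ha _ hs) x

end Corrector

end Literature.Analysis.FluidPDE

end
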